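import Mathlib.Analysis.Calculus.Deriv.MeanValue
import Mathlib.MeasureTheory.Integral.Bochner.Set
import Mathlib.MeasureTheory.Measure.Lebesgue.Basic
import HarnessLib

/-!
# Envelope through an a.e. good set, uniform partitions and step functions

Analysis/FluidPDE support file (folklore real analysis). It provides the infrastructure consumed
by `GeneralizedEnergyInequality.lean` (`intervalIntegral_le_integral_mul_of_restart`: the
generalized energy inequality `∫_{E(0)}^{E(T)} ψ ≤ ∫₀ᵀ ψ(E) h` from an a.e.-restarted energy
inequality `E(t) - A(t) ≤ E(s) - A(s)`, `s` in a full-measure set `G ∋ 0`, `t ∈ [s, T]`, which in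
turn serves the discharge of `Literature.Analysis.FluidPDE.timeAverage_isStationary`,
Foias–Manley–Rosa–Temam 2001, Ch. IV Thm. 3.1, property (1.31)). Contents:

* `exists_sub_eq_deriv_mul` — the mean value theorem with unordered endpoints,
  `ρ q - ρ p = ψ ξ (q - p)` for some `ξ ∈ [[p, q]]` when `ρ' = ψ` everywhere;
* `restartEnvelope z G` — `m(t) = inf {z(s) : s ∈ G, s ≤ max(t,0)}`, the nonincreasing envelope
  of `z` through the good set: `restartEnvelope_antitone`, `le_restartEnvelope` (`z ≤ m` on
  `[0, T]`), `restartEnvelope_eq` (`m = z` on `G`), under `0 ∈ G ⊆ [0, T]` and the restart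
  hypothesis `z t ≤ z s` (`s ∈ G`, `t ∈ [s, T]`);
* `ptn T n i = iT/n`, `ptnIdx`, `stepFun` — uniform partitions of `[0, T]`, the index of the
  interval containing a point, step functions constant on the partition intervals, and
  `setIntegral_stepFun_mul` (`∫_{(0,T]} step · g = ∑ᵢ cᵢ ∫_{(tᵢ,tᵢ₊₁]} g`).

## Mathlib search

Used: `exists_hasDerivAt_eq_slope` (MVT), `csInf_le_csInf` / `le_csInf` / `csInf_le`,
`Nat.ceil_eq_iff`, `Nat.ceil_lt_add_one`, `MeasureTheory.integral_indicator`,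
`MeasureTheory.integral_finsetSum`. No running-infimum-through-a-subset or uniform-partition step
function API exists in Mathlib (searched `envelope`, `runningMin`, `stepFun`, `partition` in
`MeasureTheory`/`Analysis`).

## References

* C. Foias, O. Manley, R. Rosa, R. Temam, *Navier–Stokes Equations and Turbulence*, Cambridge
  Univ. Press (2001), App. IV.B.2, (B.32)–(B.35) (PDF pp. 259–261): the partition argument this
  infrastructure formalises. [FMRT2001]
-/

noncomputable section

open MeasureTheory Set Filter Topology

namespace Literature.Analysis.FluidPDE

/-! ### Mean value theorem, unordered endpoints -/

/-- The mean value theorem for a function with derivative `ψ` everywhere, endpoints in any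
order: `ρ q - ρ p = ψ ξ (q - p)` for some `ξ` between `p` and `q`. [folklore] -/
theorem exists_sub_eq_deriv_mul {ρ ψ : ℝ → ℝ} (hρ : ∀ x, HasDerivAt ρ (ψ x) x) (p q : ℝ) :
    ∃ ξ ∈ uIcc p q, ρ q - ρ p = ψ ξ * (q - p) := by
  have hcont : Continuous ρ := continuous_iff_continuousAt.2 fun x => (hρ x).continuousAt
  rcases lt_trichotomy p q with hpq | rfl | hqp
  · obtain ⟨ξ, hξ, hξeq⟩ := exists_hasDerivAt_eq_slope ρ ψ hpq hcont.continuousOn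
      fun x _ => hρ x
    refine ⟨ξ, by rw [uIcc_of_le hpq.le]; exact Ioo_subset_Icc_self hξ, ?_⟩
    rw [hξeq, div_mul_cancel₀ _ (sub_ne_zero.2 hpq.ne')]
  · exact ⟨p, left_mem_uIcc, by simp⟩
  · obtain ⟨ξ, hξ, hξeq⟩ := exists_hasDerivAt_eq_slope ρ ψ hqp hcont.continuousOn
      fun x _ => hρ x
    refine ⟨ξ, by rw [uIcc_of_ge hqp.le]; exact Ioo_subset_Icc_self hξ, ?_⟩
    have hne : p - q ≠ 0 := sub_ne_zero.2 hqp.ne'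
    rw [hξeq, div_mul_eq_mul_div, eq_div_iff hne]
    ring

/-! ### The nonincreasing envelope through good points -/

section Envelope

variable {z : ℝ → ℝ} {G : Set ℝ} {T : ℝ}

/-- The **nonincreasing envelope** of `z` through the good set `G`:
`m(t) = inf {z(s) : s ∈ G, s ≤ max(t, 0)}`. [folklore] -/
def restartEnvelope (z : ℝ → ℝ) (G : Set ℝ) (t : ℝ) : ℝ :=
  sInf (z '' {s | s ∈ G ∧ s ≤ max t 0})

/-- The sets defining the envelope are bounded below by `z T` when `z(T) ≤ z(s)` for good `s`. [folklore] -/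
theorem bddBelow_image_restart (hGT : G ⊆ Icc 0 T) (hz : ∀ s ∈ G, ∀ t ∈ Icc s T, z t ≤ z s)
    (t : ℝ) : BddBelow (z '' {s | s ∈ G ∧ s ≤ max t 0}) :=
  ⟨z T, by
    rintro _ ⟨s, ⟨hs, -⟩, rfl⟩
    exact hz s hs T ⟨(hGT hs).2, le_rfl⟩⟩

/-- The envelope is nonincreasing. [folklore] -/
theorem restartEnvelope_antitone (hG0 : (0 : ℝ) ∈ G) (hGT : G ⊆ Icc 0 T)
    (hz : ∀ s ∈ G, ∀ t ∈ Icc s T, z t ≤ z s) : Antitone (restartEnvelope z G) := by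
  intro t t' htt'
  refine csInf_le_csInf (bddBelow_image_restart hGT hz t') ⟨z 0, 0, ⟨hG0, le_max_right _ _⟩, rfl⟩
    (image_mono fun s hs => ⟨hs.1, hs.2.trans (max_le_max htt' le_rfl)⟩)

/-- `z ≤ m` on `[0, T]`: every good `s ≤ t` has `z(t) ≤ z(s)`. [folklore] -/
theorem le_restartEnvelope (hG0 : (0 : ℝ) ∈ G) (hz : ∀ s ∈ G, ∀ t ∈ Icc s T, z t ≤ z s)
    {t : ℝ} (ht : t ∈ Icc 0 T) : z t ≤ restartEnvelope z G t := by
  refine le_csInf ⟨z 0, 0, ⟨hG0, le_max_right _ _⟩, rfl⟩ ?_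
  rintro _ ⟨s, ⟨hs, hst⟩, rfl⟩
  rw [max_eq_left ht.1] at hst
  exact hz s hs t ⟨hst, ht.2⟩

/-- `m = z` at good points. [folklore] -/
theorem restartEnvelope_eq (hG0 : (0 : ℝ) ∈ G) (hGT : G ⊆ Icc 0 T)
    (hz : ∀ s ∈ G, ∀ t ∈ Icc s T, z t ≤ z s) {t : ℝ} (ht : t ∈ G) : restartEnvelope z G t = z t :=
  le_antisymm (csInf_le (bddBelow_image_restart hGT hz t) ⟨t, ⟨ht, le_max_of_le_left le_rfl⟩, rfl⟩)
    (le_restartEnvelope hG0 hz (hGT ht))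

end Envelope

/-! ### Uniform partitions of `[0, T]` and step functions -/

section Partition

/-- The `i`-th point `i T / n` of the uniform partition of `[0, T]` into `n` pieces. [folklore] -/
def ptn (T : ℝ) (n i : ℕ) : ℝ := (i : ℝ) * T / n

/-- `ptn T n 0 = 0`. [folklore] -/
theorem ptn_zero (T : ℝ) (n : ℕ) : ptn T n 0 = 0 := by simp [ptn]

/-- `ptn T n n = T` for `n ≠ 0`. [folklore] -/
theorem ptn_self {T : ℝ} {n : ℕ} (hn : n ≠ 0) : ptn T n n = T := by
  have : (n : ℝ) ≠ 0 := Nat.cast_ne_zero.2 hn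
  simp [ptn, this]

/-- Consecutive partition points differ by `T / n`. [folklore] -/
theorem ptn_succ_sub (T : ℝ) (n i : ℕ) : ptn T n (i + 1) - ptn T n i = T / n := by
  simp only [ptn, Nat.cast_add, Nat.cast_one]
  ring

/-- The partition points are monotone in the index (`T ≥ 0`). [folklore] -/
theorem ptn_mono {T : ℝ} (hT : 0 ≤ T) (n : ℕ) {i j : ℕ} (hij : i ≤ j) : ptn T n i ≤ ptn T n j := by
  unfold ptn
  rcases Nat.eq_zero_or_pos n with hn | hn
  · subst hn; simp
  · have : (0 : ℝ) < n := by exact_mod_cast hn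
    rw [div_le_div_iff_of_pos_right this]
    exact mul_le_mul_of_nonneg_right (by exact_mod_cast hij) hT

/-- The partition points lie in `[0, T]` for `i ≤ n` (`T ≥ 0`). [folklore] -/
theorem ptn_mem_Icc {T : ℝ} (hT : 0 ≤ T) {n i : ℕ} (hn : n ≠ 0) (hi : i ≤ n) : ptn T n i ∈ Icc 0 T :=
  ⟨(ptn_zero T n).symm.le.trans (ptn_mono hT n (Nat.zero_le i)),
    (ptn_mono hT n hi).trans_eq (ptn_self hn)⟩

/-- The index of the partition interval `(tᵢ, tᵢ₊₁]` containing `τ ∈ (0, T]`: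
`i = ⌈τ n / T⌉ - 1`. [folklore] -/
def ptnIdx (T : ℝ) (n : ℕ) (τ : ℝ) : ℕ := ⌈τ * n / T⌉₊ - 1

/-- For `τ ∈ (0, T]` and `n ≥ 1`: the index is `< n` and `τ ∈ (tᵢ, tᵢ₊₁]`. [folklore] -/
theorem ptnIdx_spec {T : ℝ} (hT : 0 < T) {n : ℕ} (hn : n ≠ 0) {τ : ℝ} (hτ : τ ∈ Ioc 0 T) :
    ptnIdx T n τ < n ∧ τ ∈ Ioc (ptn T n (ptnIdx T n τ)) (ptn T n (ptnIdx T n τ + 1)) := by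
  have hn' : (0 : ℝ) < n := by exact_mod_cast Nat.pos_of_ne_zero hn
  have hτ0 : 0 < τ := hτ.1
  set x : ℝ := τ * n / T with hx
  have hx0 : 0 < x := by positivity
  have hxn : x ≤ n := by
    rw [hx, div_le_iff₀ hT]
    exact mul_le_mul_of_nonneg_right hτ.2 hn'.le |>.trans_eq (mul_comm _ _)
  have hceil_pos : 1 ≤ ⌈x⌉₊ := Nat.one_le_iff_ne_zero.2 (Nat.pos_iff_ne_zero.1 (Nat.ceil_pos.2 hx0))
  have hceil_le : ⌈x⌉₊ ≤ n := Nat.ceil_le.2 hxn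
  have hidx : (ptnIdx T n τ : ℝ) = ⌈x⌉₊ - 1 := by
    rw [ptnIdx, ← hx, Nat.cast_sub hceil_pos, Nat.cast_one]
  refine ⟨by unfold ptnIdx; rw [← hx]; omega, ?_, ?_⟩
  · -- `tᵢ < τ`
    show (ptnIdx T n τ : ℝ) * T / n < τ
    rw [hidx, div_lt_iff₀ hn', sub_mul, one_mul]
    have h1 : (⌈x⌉₊ : ℝ) < x + 1 := Nat.ceil_lt_add_one hx0.le
    have h2 : x * T = τ * n := by rw [hx]; field_simp
    nlinarith
  · -- `τ ≤ tᵢ₊₁`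
    show τ ≤ ((ptnIdx T n τ + 1 : ℕ) : ℝ) * T / n
    rw [Nat.cast_add, Nat.cast_one, hidx, sub_add_cancel, le_div_iff₀ hn']
    have h1 : x ≤ ⌈x⌉₊ := Nat.le_ceil x
    have h2 : x * T = τ * n := by rw [hx]; field_simp
    nlinarith

/-- Uniqueness of the partition interval containing `τ`. [folklore] -/
theorem eq_ptnIdx_of_mem {T : ℝ} (hT : 0 < T) {n : ℕ} (hn : n ≠ 0) {τ : ℝ} {j : ℕ}
    (hj : τ ∈ Ioc (ptn T n j) (ptn T n (j + 1))) : j = ptnIdx T n τ := by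
  have hn' : (0 : ℝ) < n := by exact_mod_cast Nat.pos_of_ne_zero hn
  set x : ℝ := τ * n / T with hx
  have h2 : x * T = τ * n := by rw [hx]; field_simp
  have hlo : (j : ℝ) < x := by
    have := hj.1
    unfold ptn at this
    rw [div_lt_iff₀ hn'] at this
    nlinarith
  have hhi : x ≤ j + 1 := by
    have := hj.2
    unfold ptn at this
    rw [le_div_iff₀ hn', Nat.cast_add, Nat.cast_one] at this
    nlinarith
  have hceil : ⌈x⌉₊ = j + 1 := by
    rw [Nat.ceil_eq_iff (Nat.succ_ne_zero j)]
    exact ⟨by simpa using hlo, by exact_mod_cast hhi⟩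
  unfold ptnIdx
  rw [← hx, hceil]
  rfl

/-- The **step function** with value `c i` on the partition interval `(tᵢ, tᵢ₊₁]`, `i < n`,
and `0` off `(0, T]`. [folklore] -/
def stepFun (T : ℝ) (n : ℕ) (c : ℕ → ℝ) (τ : ℝ) : ℝ :=
  ∑ i ∈ Finset.range n, (Ioc (ptn T n i) (ptn T n (i + 1))).indicator (fun _ => c i) τ

/-- The step function is measurable. [folklore] -/
theorem measurable_stepFun (T : ℝ) (n : ℕ) (c : ℕ → ℝ) : Measurable (stepFun T n c) :=
  Finset.measurable_sum _ fun _ _ => measurable_const.indicator measurableSet_Ioc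

/-- On `(0, T]` the step function takes the value attached to the interval containing the
point. [folklore] -/
theorem stepFun_eq {T : ℝ} (hT : 0 < T) {n : ℕ} (hn : n ≠ 0) (c : ℕ → ℝ) {τ : ℝ} (hτ : τ ∈ Ioc 0 T) :
    stepFun T n c τ = c (ptnIdx T n τ) := by
  obtain ⟨hlt, hmem⟩ := ptnIdx_spec hT hn hτ
  unfold stepFun
  rw [Finset.sum_eq_single (ptnIdx T n τ)]
  · rw [indicator_of_mem hmem]
  · intro j _ hj
    rw [indicator_of_notMem]
    exact fun h => hj (eq_ptnIdx_of_mem hT hn h)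
  · intro h
    exact absurd (Finset.mem_range.2 hlt) h

/-- Off `(0, T]` the step function vanishes (`T ≥ 0`). [folklore] -/
theorem stepFun_eq_zero {T : ℝ} (hT : 0 ≤ T) {n : ℕ} (c : ℕ → ℝ) {τ : ℝ} (hτ : τ ∉ Ioc 0 T) :
    stepFun T n c τ = 0 := by
  rcases Nat.eq_zero_or_pos n with hn | hn
  · subst hn; simp [stepFun]
  refine Finset.sum_eq_zero fun i hi => indicator_of_notMem (fun h => hτ ?_) _
  have hi' : i + 1 ≤ n := Finset.mem_range.1 hi
  exact ⟨(ptn_mem_Icc hT hn.ne' (Nat.le_of_succ_le hi')).1.trans_lt h.1,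
    h.2.trans (ptn_mem_Icc hT hn.ne' hi').2⟩

/-- **Integration against the step function**: `∫_{(0,T]} step · g = ∑ᵢ cᵢ ∫_{(tᵢ,tᵢ₊₁]} g` for `g`
integrable on `(0, T]`. [folklore] -/
theorem setIntegral_stepFun_mul {T : ℝ} (hT : 0 ≤ T) {n : ℕ} (hn : n ≠ 0) (c : ℕ → ℝ) {g : ℝ → ℝ}
    (hg : IntegrableOn g (Ioc 0 T)) :
    ∫ τ in Ioc 0 T, stepFun T n c τ * g τ =
      ∑ i ∈ Finset.range n, c i * ∫ τ in Ioc (ptn T n i) (ptn T n (i + 1)), g τ := by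
  have hsub : ∀ i ∈ Finset.range n, Ioc (ptn T n i) (ptn T n (i + 1)) ⊆ Ioc 0 T := fun i hi => by
    have hi' : i + 1 ≤ n := Finset.mem_range.1 hi
    exact Ioc_subset_Ioc (ptn_mem_Icc hT hn (Nat.le_of_succ_le hi')).1 (ptn_mem_Icc hT hn hi').2
  have hint : ∀ i ∈ Finset.range n, Integrable (fun τ => (Ioc (ptn T n i) (ptn T n (i + 1))).indicator
      (fun _ => c i) τ * g τ) (volume.restrict (Ioc 0 T)) := fun i _ => by
    refine (hg.norm.const_mul ‖c i‖).mono' ?_ (ae_of_all _ fun τ => ?_)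
    · exact ((measurable_const.indicator measurableSet_Ioc).aestronglyMeasurable).mul hg.1
    · rw [norm_mul]
      refine mul_le_mul_of_nonneg_right ?_ (norm_nonneg _)
      by_cases h : τ ∈ Ioc (ptn T n i) (ptn T n (i + 1))
      · rw [indicator_of_mem h]
      · rw [indicator_of_notMem h, norm_zero]; exact norm_nonneg _
  unfold stepFun
  simp_rw [Finset.sum_mul]
  rw [integral_finsetSum _ hint]
  refine Finset.sum_congr rfl fun i hi => ?_
  have hmul : (fun τ => (Ioc (ptn T n i) (ptn T n (i + 1))).indicator (fun _ => c i) τ * g τ) =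
      (Ioc (ptn T n i) (ptn T n (i + 1))).indicator (fun τ => c i * g τ) := by
    funext τ
    by_cases h : τ ∈ Ioc (ptn T n i) (ptn T n (i + 1))
    · rw [indicator_of_mem h, indicator_of_mem h]
    · rw [indicator_of_notMem h, indicator_of_notMem h, zero_mul]
  rw [hmul, MeasureTheory.integral_indicator measurableSet_Ioc, Measure.restrict_restrict measurableSet_Ioc,
    inter_eq_left.2 (hsub i hi), MeasureTheory.integral_const_mul]

end Partition

end Literature.Analysis.FluidPDE
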